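import Summits.BirchSwinnertonDyer.BirchSwinnertonDyer.Theses.ErratumRoadFive
import Summits.BirchSwinnertonDyer.BirchSwinnertonDyer.Theorems.ErratumRoadFiveRest3NoWitnessOffLocusKolyvaginTam
import HarnessLib

/-!
# Route `ErratumRoadFive` (rung K2), crux `Rest3NoWitnessBranchAtFive` (item stmt-BirchSwinnertonDyer-19703), stub
# `stub_nw_offLocus`: the Tamagawa-refined Kolyvagin road BY THE ROUTE'S NAMES — `PublishedInputsFive` (19066) +
# `JSWAnticyclotomicControlMult` (19626) + Shimura reciprocity + McCallum + Darmon 3.6 + the refined ♯-hypothesis `hZt`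
# ⟹ the registered signature VERBATIM (cell `bsd-stepL`, ACCEL seat `bsd-stepL-nw1` g0; `--supports stmt-BirchSwinnertonDyer-19703`)

Companion of `ErratumRoadFiveRest3NoWitnessOffLocusKolyvaginTam.lean` (Theses-free; this file imports the route file only to
name its support items, as rest-p2's `ErratumRoadFiveRest3NoWitnessLocusFromKolyvaginSharp.lean` does for `stub_nw_locus`).
THEOREMS ONLY (no definition, no named fact, no `sorry`); CONDITIONAL on every displayed binder; `hZt` (a Kolyvagin certificate of
level `M + 1`, `M ≤ ord_p ∏ c_ℓ(E)`, at the Hoffstein–Luo frames of the (NW) ∩ off-Locus pairs — W. Zhang's refined non-vanishing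
`M_∞ ≤ ord_p ∏ c_ℓ` at a multiplicative `p ≥ 5`) is conjecture-shaped and OPEN (refereed at good ordinary `p` only:
Burungale–Castella–Grossi–Skinner, Camb. J. Math., Thm. 2); nothing is booked; BSD is proved for no pair; no census word moves (T7).

* `nwOffLocus_of_publishedInputsFive_of_kolyvaginTamFramesHL` — `stub_nw_offLocus` VERBATIM ⟸ `PublishedInputsFive` +
  `JSWAnticyclotomicControlMult` + `hrec` + `hMc` + `h36` + `hZt` (destructure the conjunction, apply the Theses-free theorem
  `stub_nw_offLocus_of_kolyvaginTamFramesHL_of_thm331Mult`).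
* `rest3NoWitness_onRam_of_publishedInputsFive_of_kolyvaginTamFramesHL` — the whole (ram) atom of X11b at `p ≥ 5` by name
  (`openInputOnTree_onRam_of_kolyvaginTamFramesHL_of_thm331Mult`): Locus, off-Locus and the (T) branch from ONE ♯-family.

References: [McCallumLMS1991] §5 Cor. 5.6; [WZhang2014] Thm. 1.1, Remark 5; [SkinnerZhang2014] Thm. 1.3; [Darmon2004] Thm. 3.6;
[JetchevSkinnerWan2017] Thm. 3.3.1, §7.4.1; [Castella2018Erratum] Thm. 1.1 (iii)–(iv).
-/

set_option autoImplicit false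
-- the Theorems namespace of this sub repeats the summit name by design (D-0017 nested layout)
set_option linter.dupNamespace false

noncomputable section

open scoped Classical

namespace Summit.BirchSwinnertonDyer.BirchSwinnertonDyer.Theorems

open WeierstrassCurve Literature.NumberTheory.EllipticCurves
  Literature.NumberTheory.EllipticCurves.ModularForms
  Literature.NumberTheory.EllipticCurves.Rank1Residual
  Summit.BirchSwinnertonDyer.Rank1Residual Summit.BirchSwinnertonDyer.Rank1Residual.X11b
  Summit.BirchSwinnertonDyer.Rank1Residual.X11b.Three.Koly
  Summit.BirchSwinnertonDyer.BirchSwinnertonDyer.Theses.ErratumRoadFive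

/-- **`stub_nw_offLocus` (crux 19703) BY THE ROUTE'S NAMES ⟸ `hZt`**: `PublishedInputsFive` (19066) +
`JSWAnticyclotomicControlMult` (19626) + `hrec` (Shimura reciprocity at conductor 1) + `hMc` (McCallum Cor. 5.6) + `h36`
(Darmon Thm. 3.6) + the refined ♯-hypothesis `hZt` asked ONLY on the (NW) ∩ off-Locus pairs (a Kolyvagin certificate of level
`M + 1`, `M ≤ ord_p ∏ c_ℓ(E)`, at every Manin-good conductor-1 frame of every Hoffstein–Luo field — OPEN at `p ∥ N`).
CONDITIONAL; nothing booked. [cite: McCallumLMS1991, §5 Cor. 5.6 (p. 310)] [cite: Darmon2004, Thm. 3.6]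
[cite: SkinnerZhang2014, Thm. 1.3 (shape of `hZt` at t = 0)] [cite: JetchevSkinnerWan2017, Thm. 3.3.1] -/
theorem nwOffLocus_of_publishedInputsFive_of_kolyvaginTamFramesHL
    (hF : PublishedInputsFive) (h331 : JSWAnticyclotomicControlMult)
    (hrec : ∀ (N : ℕ) [NeZero N] (W : WeierstrassCurve ℚ) (K : Type) [Field K] [NumberField K],
      heegnerPointOfConductor_one_galoisConj N W K)
    (hMc : McCallum1991_pow_dvd_card_sha_primary_of_certificate)
    (h36 : ∀ (N : ℕ) [NeZero N] (W : WeierstrassCurve ℚ) (K : Type) [Field K] [NumberField K],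
      phi_heegnerTau_mem_range_map_singularModuliField N W K)
    (hZt : ∀ (W : WeierstrassCurve ℚ) [W.IsElliptic] [W.IsGloballyMinimal] [NeZero (W.conductorNorm ℤ)]
      (p : ℕ) [Fact p.Prime] (K : Type) [Field K] [NumberField K]
      (Dt : ModularParametrizationData W (W.conductorNorm ℤ)) (β : ℤ) (ι : K →+* ℂ),
      ClassX11b W p → 5 ≤ p → W.HasMultiplicativeReductionAtPrime p → Rank1Residual.Surj W p →
      Rank1Residual.Ram W p → p ∣ W.tamagawaProduct →
      (∀ P : (W.baseChange ℚ_[p]).toAffine.Point, p • P = 0 → P = 0) →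
      (∀ (q : ℕ) [Fact q.Prime], q ≠ 2 → q ≠ p → Rank1Residual.Mult W q →
        ¬ W.HasSplitMultiplicativeReductionAtPrime q → p ∣ padicValInt q W.minimalDiscriminantInt) →
      IsImaginaryQuadratic K → Odd (NumberField.discr K) →
      SatisfiesHeegnerHypothesis (W.conductorNorm ℤ) K →
      (W.quadraticTwist (NumberField.discr K : ℚ)).entireLFunction 1 ≠ 0 →
      NumberField.discr K ≠ -3 →
      (4 * (W.conductorNorm ℤ : ℤ)) ∣ β ^ 2 - NumberField.discr K → ¬ (p : ℤ) ∣ Dt.c →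
      ∃ M : ℕ, M ≤ padicValNat p W.tamagawaProduct ∧ CertificateAt Dt β ι p M) :
    ∀ (W : WeierstrassCurve ℚ) [W.IsElliptic] [W.IsGloballyMinimal] (p : ℕ) [Fact p.Prime],
      Literature.NumberTheory.EllipticCurves.Rank1Residual.Ram W p →
      (∀ P : (W.baseChange ℚ_[p]).toAffine.Point, p • P = 0 → P = 0) →
      ¬ (∃ (q : ℕ) (_ : Fact q.Prime), q ≠ 2 ∧ q ≠ p ∧ Literature.NumberTheory.EllipticCurves.Rank1Residual.Mult W q ∧
          ¬ W.HasSplitMultiplicativeReductionAtPrime q ∧ ¬ p ∣ padicValInt q W.minimalDiscriminantInt) →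
      p ∣ W.tamagawaProduct →
      Summit.BirchSwinnertonDyer.Rank1Residual.X11b.P2OpenInputOnTreeAt W p := by
  obtain ⟨hGZ, hKo, -, hSk, -, hGZK, hmod, hnf, hHL, -, hMaz, -, -, -, -⟩ := hF
  exact stub_nw_offLocus_of_kolyvaginTamFramesHL_of_thm331Mult hGZ hKo hSk hGZK hmod hnf hHL hMaz hrec hMc h36 h331 hZt

/-- **The whole (ram) atom of X11b at `p ≥ 5` BY THE ROUTE'S NAMES ⟸ the refined ♯-family `hZt`** (class level; Locus,
off-Locus and the torsion branch (T) alike — ONE hypothesis family indexed by the Tamagawa exponent `t = ord_p ∏ c_ℓ(E)`):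
`PublishedInputsFive` + `JSWAnticyclotomicControlMult` + `hrec` + `hMc` + `h36` + `hZt` ⟹ `P2OpenInputOnTreeAt W p` at every
X11b pair with `p ≥ 5` and a (ram) witness. CONDITIONAL; nothing booked. [cite: McCallumLMS1991, §5 Cor. 5.6 (p. 310)]
[cite: Darmon2004, Thm. 3.6] [cite: WZhang2014, Thm. 1.1 and Remark 5 (shape of `hZt`)] [cite: JetchevSkinnerWan2017, Thm. 3.3.1] -/
theorem rest3NoWitness_onRam_of_publishedInputsFive_of_kolyvaginTamFramesHL
    (hF : PublishedInputsFive) (h331 : JSWAnticyclotomicControlMult)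
    (hrec : ∀ (N : ℕ) [NeZero N] (W : WeierstrassCurve ℚ) (K : Type) [Field K] [NumberField K],
      heegnerPointOfConductor_one_galoisConj N W K)
    (hMc : McCallum1991_pow_dvd_card_sha_primary_of_certificate)
    (h36 : ∀ (N : ℕ) [NeZero N] (W : WeierstrassCurve ℚ) (K : Type) [Field K] [NumberField K],
      phi_heegnerTau_mem_range_map_singularModuliField N W K)
    (hZt : ∀ (W : WeierstrassCurve ℚ) [W.IsElliptic] [W.IsGloballyMinimal] [NeZero (W.conductorNorm ℤ)]
      (p : ℕ) [Fact p.Prime] (K : Type) [Field K] [NumberField K]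
      (Dt : ModularParametrizationData W (W.conductorNorm ℤ)) (β : ℤ) (ι : K →+* ℂ),
      ClassX11b W p → 5 ≤ p → W.HasMultiplicativeReductionAtPrime p → Rank1Residual.Surj W p →
      Rank1Residual.Ram W p →
      IsImaginaryQuadratic K → Odd (NumberField.discr K) →
      SatisfiesHeegnerHypothesis (W.conductorNorm ℤ) K →
      (W.quadraticTwist (NumberField.discr K : ℚ)).entireLFunction 1 ≠ 0 →
      NumberField.discr K ≠ -3 →
      (4 * (W.conductorNorm ℤ : ℤ)) ∣ β ^ 2 - NumberField.discr K → ¬ (p : ℤ) ∣ Dt.c →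
      ∃ M : ℕ, M ≤ padicValNat p W.tamagawaProduct ∧ CertificateAt Dt β ι p M) :
    ∀ (W : WeierstrassCurve ℚ) [W.IsElliptic] [W.IsGloballyMinimal] (p : ℕ) [Fact p.Prime],
      ClassX11b W p → 5 ≤ p → Rank1Residual.Ram W p → P2OpenInputOnTreeAt W p := by
  obtain ⟨hGZ, hKo, -, hSk, -, hGZK, hmod, hnf, hHL, -, hMaz, -, -, -, -⟩ := hF
  exact openInputOnTree_onRam_of_kolyvaginTamFramesHL_of_thm331Mult hGZ hKo hSk hGZK hmod hnf hHL hMaz hrec hMc h36 h331 hZt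

end Summit.BirchSwinnertonDyer.BirchSwinnertonDyer.Theorems

end
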